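import Mathlib
import Literature.NumberTheory.Transcendental.GammaFields
import Literature.NumberTheory.Transcendental.GammaFieldRegularity
import Literature.NumberTheory.Transcendental.ZilberFieldSaturationMain
import Summits.Schanuel.Schanuel.Theorems.RigidCoreAclSubsetLogFreeCoreCaseI
import Summits.Schanuel.Schanuel.Theorems.RigidCoreAclSubsetLogFreeCoreCaseIIShift

/-!
# Case II core, file 11: assembly lemmas
(helper file for the registered stub `stub_caseII_core` of line `eac-extends-core-automorphisms`,
crux stmt-Schanuel-0968 `Summit.Schanuel.Schanuel.Theses.RigidCore.AclSubsetLogFreeCore`)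

Small lemmas feeding the level induction with its data:
* `isAlgClosed_subfield_of_forall_mem` — a relatively algebraically closed subfield of an
  algebraically closed field is algebraically closed;
* `exists_basis_mod` — a basis of `Λ'` modulo `Λ` for a finitely generated extension `Λ ≤ Λ'`;
* `algebraicIndependent_level` — the level-`N` coordinates `exp (b i / N)` of a basis `b` of an
  A-extension of a strong `W` are algebraically independent over `acl ℚ(gens W)`
  (`Literature…algebraicIndependent_exp_div_factorial_family`);
* `exp_eq_one_iff_of_kernel`, `isStrong_base`, `apply_mem_aclGens_iff`.
-/

noncomputable section

set_option linter.dupNamespace false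

open Set
open scoped BigOperators
open Literature.ModelTheory.ExponentialFields Literature.ModelTheory.ExponentialFields.ExponentialRing
open Literature.NumberTheory.Transcendental Literature.NumberTheory.Transcendental.GammaField

namespace Summit.Schanuel.Schanuel.Theorems.RigidCore

namespace CaseIICore

variable {E : Type*} [Field E] [CharZero E] [ExponentialRing E]

omit [CharZero E] [ExponentialRing E] in
/-- A relatively algebraically closed subfield of an algebraically closed field is algebraically
closed. [folklore] -/
theorem isAlgClosed_subfield_of_forall_mem [IsAlgClosed E] (k : Subfield E)
    (hk : ∀ z, IsAlgebraic k z → z ∈ k) : IsAlgClosed k := by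
  apply IsAlgClosed.of_exists_root
  intro p _ hirr
  have hdeg : (p.map (algebraMap k E)).degree ≠ 0 := by
    rw [Polynomial.degree_map]
    exact (Polynomial.degree_pos_of_irreducible hirr).ne'
  obtain ⟨z, hz⟩ := IsAlgClosed.exists_root _ hdeg
  have hz' : Polynomial.aeval z p = 0 := by
    rw [Polynomial.aeval_def, ← Polynomial.eval_map]; exact hz
  have halg : IsAlgebraic k z := ⟨p, hirr.ne_zero, hz'⟩
  refine ⟨⟨z, hk z halg⟩, ?_⟩
  apply (algebraMap k E).injective
  rw [map_zero, ← Polynomial.aeval_algebraMap_apply_eq_algebraMap_eval]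
  exact hz'

omit [ExponentialRing E] in
/-- **A basis modulo `Λ`** of a finitely generated extension `Λ ≤ Λ'`. [folklore] -/
theorem exists_basis_mod {Λ Λ' : Submodule ℚ E} (hfg : IsFG Λ Λ') :
    ∃ (p : ℕ) (b : Fin p → E), (∀ i, b i ∈ Λ') ∧
      (∀ y ∈ Λ', ∃ r : Fin p → ℚ, y - ∑ i, r i • b i ∈ Λ) ∧
      (∀ r : Fin p → ℚ, (∑ i, r i • b i) ∈ Λ → r = 0) := by
  classical
  obtain ⟨s, hsΛ', hle⟩ := isFG_iff_exists_finset.1 hfg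
  set c : Fin s.card → E := fun i => (s.equivFin.symm i : E) with hc
  have hrange : range c = (s : Set E) := by
    ext z
    constructor
    · rintro ⟨i, rfl⟩; exact (s.equivFin.symm i).2
    · intro hz; exact ⟨s.equivFin ⟨z, hz⟩, by simp [hc]⟩
  obtain ⟨r, σ, hind, hspan⟩ := ZilberSaturationMain.exists_linIndepOver_comp Λ c
  refine ⟨r, c ∘ σ, fun i => hsΛ' (s.equivFin.symm (σ i)).2, fun y hy => ?_, fun q hq => hind q hq⟩
  have hy' : y ∈ Λ ⊔ Submodule.span ℚ (range (c ∘ σ)) := by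
    rw [hspan, hrange]; exact hle hy
  obtain ⟨w, hw, z, hz, rfl⟩ := Submodule.mem_sup.1 hy'
  obtain ⟨q, rfl⟩ := (Submodule.mem_span_range_iff_exists_fun ℚ).1 hz
  exact ⟨q, by simpa using hw⟩

/-- **Algebraic independence of the level coordinates** over the relative algebraic closure of the
Γ-field of a strong `W`: for `b` algebraic over `ℚ(gens W)` and linearly independent modulo `W`,
the `exp (b i / N)` are algebraically independent over `acl ℚ(gens W)`.
[cite: BaysKirby2018ANT, Lemma 4.8, §4.4] -/
theorem algebraicIndependent_level (k : Subfield E) {W : Submodule ℚ E} (hW : IsStrong W)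
    (hk : (k : Set E) = acl (gens W)) {p : ℕ} (b : Fin p → E) (hb : ∀ i, b i ∈ acl (gens W))
    (hlin : ∀ r : Fin p → ℚ, (∑ i, r i • b i) ∈ W → r = 0) {N : ℕ} (hN : 0 < N) :
    AlgebraicIndependent k (fun i => exp ((1 / (N : ℚ)) • b i)) := by
  -- the intermediate field with the same carrier
  set S : IntermediateField ℚ E := k.toIntermediateField (fun q => by
    rw [show algebraMap ℚ E q = (q : E) from rfl]; exact SubfieldClass.ratCast_mem k q) with hS
  have hScoe : (S : Set E) = (k : Set E) := Subfield.coe_toIntermediateField k _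
  -- rescaled tuple
  set x : Fin p → E := fun i => (((N - 1).factorial : ℕ) : ℚ) • b i with hx
  have hxacl : ∀ j, x j ∈ acl (gens W) := fun j => smul_mem_acl _ (hb j)
  have hxind : LinIndepOver W x := by
    intro q hq
    have hq' : (fun i => q i * (((N - 1).factorial : ℕ) : ℚ)) = 0 := by
      apply hlin
      have : ∑ i, (q i * (((N - 1).factorial : ℕ) : ℚ)) • b i = ∑ i, q i • x i :=
        Finset.sum_congr rfl fun i _ => by rw [hx, smul_smul]
      rw [this]; exact hq
    funext i
    have hi := congrFun hq' i
    have hf : (((N - 1).factorial : ℕ) : ℚ) ≠ 0 := by exact_mod_cast (Nat.factorial_ne_zero _)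
    simpa [hf] using hi
  have hSsub : (S : Set E) ⊆ acl (gens W ∪ range x) := by
    rw [hScoe, hk]; exact acl_mono subset_union_left
  have H := algebraicIndependent_exp_div_factorial_family hW hxacl hxind S hSsub N
  -- identify the family
  have hfam : (fun j => exp (x j / (N.factorial : E))) = fun i => exp ((1 / (N : ℚ)) • b i) := by
    funext i
    congr 1
    simp only [hx, Rat.smul_def]
    rw [← Nat.mul_factorial_pred hN.ne']
    have h1 : ((N : ℕ) : E) ≠ 0 := by exact_mod_cast hN.ne'
    have h2 : (((N - 1).factorial : ℕ) : E) ≠ 0 := by exact_mod_cast Nat.factorial_ne_zero _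
    push_cast
    field_simp
  rw [hfam] at H
  -- transport from `S` to `k`
  let f : k →+* S :=
    { toFun := fun z => ⟨z.1, by rw [← SetLike.mem_coe, hScoe]; exact z.2⟩
      map_one' := rfl
      map_mul' := fun _ _ => rfl
      map_zero' := rfl
      map_add' := fun _ _ => rfl }
  have hf : Function.Injective f := fun a b h => Subtype.ext (congrArg Subtype.val h)
  exact AlgebraicIndependent.of_ringHom_of_comp_eq f (RingHom.id E) (by exact H) hf (RingHom.ext fun _ => rfl)

/-- **The kernel**: `exp z = 1 ↔ z ∈ ℤτ`. [folklore] -/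
theorem exp_eq_one_iff_of_kernel {τ : E} (hker : expKernel E = AddSubgroup.zmultiples τ) (z : E) :
    exp z = 1 ↔ ∃ m : ℤ, z = (m : ℚ) • τ := by
  rw [← mem_expKernel_iff, hker, AddSubgroup.mem_zmultiples_iff]
  constructor
  · rintro ⟨m, rfl⟩; exact ⟨m, by rw [Int.cast_smul_eq_zsmul]⟩
  · rintro ⟨m, rfl⟩; exact ⟨m, by rw [Int.cast_smul_eq_zsmul]⟩

/-- **The base `V = X + ℚℓ` of an L-step over a strong `X` is strong** (stated in `Type`, as the
landed `predim_span_singleton_eq_zero_of_acl`). [cite: BaysKirby2018ANT, Lemma 4.8] -/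
theorem isStrong_base {E : Type} [Field E] [CharZero E] [ExponentialRing E]
    {X : Submodule ℚ E} (hXs : IsStrong X) {ℓ : E}
    (hℓexp : exp ℓ ∈ acl (gens X)) (hℓ : ℓ ∉ acl (gens X)) :
    IsStrong (X ⊔ Submodule.span ℚ {ℓ}) := by
  have hℓX : ℓ ∉ X := fun h => hℓ (subset_acl _ (mem_gens_of_mem h))
  refine hXs.of_predim_eq_zero le_sup_left
    (isFG_sup_left.2 (isFG_span_of_finite X (finite_singleton ℓ))) ?_
  rw [predim_sup_left]
  exact predim_span_singleton_eq_zero_of_acl hXs hℓX (Or.inr hℓexp)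

/-- `acl (gens Λ)` is `θ`-stable when `Λ` is. [folklore] -/
theorem apply_mem_aclGens_iff (θ : E ≃+* E) (hθ : ∀ x, θ (exp x) = exp (θ x))
    {Λ : Submodule ℚ E} (hΛ : Λ.map θ.toAddMonoidHom.toRatLinearMap = Λ) (z : E) :
    z ∈ acl (gens Λ) ↔ θ z ∈ acl (gens Λ) := by
  have h := acl_gens_map θ hθ Λ
  rw [hΛ] at h
  constructor
  · intro hz; rw [h]; exact ⟨z, hz, rfl⟩
  · intro hz
    rw [h] at hz
    obtain ⟨z', hz', he⟩ := hz
    rwa [← θ.injective he]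

end CaseIICore

/-! ### Registered helper (crux stub list of stmt-Schanuel-0968) -/

/-- **Registered form of `CaseIICore.algebraicIndependent_level`** (all binders explicit).
[cite: BaysKirby2018ANT, Lemma 4.8, §4.4] -/
theorem caseII_algebraicIndependent_level {E : Type*} [Field E] [CharZero E] [ExponentialRing E]
    (k : Subfield E) {W : Submodule ℚ E} (hW : IsStrong W)
    (hk : (k : Set E) = acl (gens W)) {p : ℕ} (b : Fin p → E) (hb : ∀ i, b i ∈ acl (gens W))
    (hlin : ∀ r : Fin p → ℚ, (∑ i, r i • b i) ∈ W → r = 0) {N : ℕ} (hN : 0 < N) :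
    AlgebraicIndependent k (fun i => exp ((1 / (N : ℚ)) • b i)) :=
  CaseIICore.algebraicIndependent_level k hW hk b hb hlin hN

end Summit.Schanuel.Schanuel.Theorems.RigidCore
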